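import Mathlib
import HarnessLib

/-!
# Transport of the cone moment by the stagnation-point conveyor: kernel algebra, critical angles, swept cone

Kernel-checked cores behind the soloist's (PL12) (HOME `paper/sharpest.md` §5.2, claim C39), continuing
`SoloBlindConeMoment.lean` (PL11).

Setting (informal; the theorems certify only the algebraic statements they display). In the `ℝ⁵ = ℝ⁴ × ℝ` picture of
axisymmetric flow (`ρ = |y'|`, Hou–Li variables `u₁, ω₁, ψ₁`, CPAM 61 (2008) eqs. (13)–(16)), the strain and the takeover
coefficient at an even stagnation point are moments of the odd field `ω₁` over the quarter plane `ρ, z > 0`: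
`σ₀ = 3∫∫ K₀ ω₁`, `K₀ = zρ³ w⁻⁵`, and `σ₂ = 15·PV∫∫ K₂ ω₁ − (6/7) ω₁,z(0,0)`, `K₂ = zρ³(4z² − 3ρ²) w⁻⁹`, `w² = ρ² + z²`
(PL11). When `ω₁` is carried by the meridional field `b = (v_r, v_z)` (`∂_ρ v_r + v_r/ρ + ∂_z v_z = 0`), a moment
`∫∫ K ω₁` changes at the rate `∫∫ ω₁ [b·∇K − K v_r/ρ]` plus an excision flux at the stagnation point; for the LINEAR
conveyor `v_r = −σ₀ρ/2`, `v_z = σ₀z` — the flow map is the anisotropic dilation `(ρ, z) ↦ (ρe^{−τ/2}, z e^{τ})`, `τ = ∫σ₀` —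
the brackets have the closed forms certified below:

  `b·∇K₀ − K₀ v_r/ρ = σ₀ · (5/2) zρ³(ρ² − 2z²) w⁻⁷`            (sign change at elevation 35.3°),
  `b·∇K₂ − K₂ v_r/ρ = −σ₀ · (7/2) zρ³(8z⁴ − 16z²ρ² + 3ρ⁴) w⁻¹¹`   (sign changes at `(z/ρ)² = 1 ∓ √10/4`: 24.6°, 53.2°),

so that (with the excision flux `(8/105)σ₀ ω₁,z(0,0)` and `W' = −σ₀W`, verified in exact rational arithmetic in HOME
`work/c39_conetransport/`) `dσ₂/dt|_conveyor = −(105/2)σ₀·PV∫∫ zρ³(8z⁴ − 16z²ρ² + 3ρ⁴)w⁻¹¹ ω₁ + 2σ₀ ω₁,z(0,0)`.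
Equivalently the conveyor dilates the kernel: the nodal cone of `K₂` seen by the initial layer is `z/ρ = (√3/2)e^{−3τ/2}`,
swept down to the plane in strain time — lifting of positive `ω₁` through the 40.9° cone is generic at the linear level,
and the sign of the cone moment is decided by the balance between the sub-cone SOURCE `∂_z(u₁²)` and the conveyor, weighed
by the lifetime moment `M(a)` of a parcel born at slope `a` (`M < 0` iff `a < 0.4436`, elevation 23.9°; a source linear in
`z` along every vertical is exactly neutral: `∫₀^∞ a M(a) da = ½[4B(5/2,2) − 3B(3/2,3)] = 0`).

Content:
* `strainKernel_conveyor_bracket` — the `K₀` bracket (a polynomial identity in `ρ, z, v = w⁻¹`; the derivative jets are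
  written out by the product/chain rule with `∂_ρ w = ρ v`, `∂_z w = z v`);
* `coneKernel_conveyor_bracket` — the `K₂` bracket, an identity modulo `v²(ρ² + z²) = 1`;
* `coneKernel_dz` — the source kernel `∂_z K₂ = ρ³(−24z⁴ + 36z²ρ² − 3ρ⁴) w⁻¹¹` (moment of `u₁²` after integration by parts);
* `conveyorBracket_neg_iff` — `8t² − 16t + 3 < 0 ↔ 1 − √10/4 < t < 1 + √10/4` (`t = (z/ρ)²`: the adverse band 24.6°–53.2°);
* `sweptCone_pos_iff` — for a dilation factor `E > 0` (`E = e^{τ/2}`), `ρ' E = ρ`, the dilated kernel factor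
  `4(zE²)² − 3ρ'²` is positive iff `(√3/2)·ρ < z·E³`: the effective cone slope is `(√3/2)E⁻³ = (√3/2)e^{−3τ/2}`;
* `neutralColumn_gamma` — the Gamma-function identity `4Γ(5/2)Γ(2) = 3Γ(3/2)Γ(3)` behind `∫₀^∞ a M(a) da = 0`.

The linter option `linter.dupNamespace` is disabled because the mandated landing namespace repeats the summit name by
design (D-0017). [problem: ns]
-/

set_option linter.dupNamespace false

namespace Summit.NavierStokesRegularity.NavierStokesRegularity.Theorems

section KernelAlgebra

/-- CONVEYOR BRACKET OF THE STRAIN KERNEL. With `v = w⁻¹`, `K₀ = zρ³·v⁵`, `∂_ρ w = ρv`, `∂_z w = zv`, the product/chain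
rule gives `∂_ρ K₀ = 3zρ²·v⁵ + zρ³·(−5v⁶·ρv)` and `∂_z K₀ = ρ³·v⁵ + zρ³·(−5v⁶·zv)`; the conveyor bracket
`−(ρ/2)∂_ρK₀ + z∂_zK₀ + K₀/2` equals `(5/2) zρ³(ρ² − 2z²)·v⁷` identically (no use of `w² = ρ² + z²` is even needed). -/
theorem strainKernel_conveyor_bracket (ρ z v : ℝ) :
    -(ρ / 2) * (3 * z * ρ ^ 2 * v ^ 5 + z * ρ ^ 3 * (-5 * v ^ 6 * (ρ * v)))
      + z * (ρ ^ 3 * v ^ 5 + z * ρ ^ 3 * (-5 * v ^ 6 * (z * v)))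
      + 1 / 2 * (z * ρ ^ 3 * v ^ 5)
    = 5 / 2 * z * ρ ^ 3 * (ρ ^ 2 - 2 * z ^ 2) * v ^ 7 := by
  ring

/-- CONVEYOR BRACKET OF THE CONE KERNEL. With `v = w⁻¹`, `v²(ρ² + z²) = 1`, `K₂ = P·v⁹`, `P = 4z³ρ³ − 3zρ⁵`
(`= zρ³(4z² − 3ρ²)`), `∂_ρP = 12z³ρ² − 15zρ⁴`, `∂_zP = 12z²ρ³ − 3ρ⁵`, `∂_ρ(v⁹) = −9v¹⁰·ρv`, `∂_z(v⁹) = −9v¹⁰·zv`, the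
conveyor bracket `−(ρ/2)∂_ρK₂ + z∂_zK₂ + K₂/2` equals `−(7/2) zρ³(8z⁴ − 16z²ρ² + 3ρ⁴)·v¹¹`: negative (the cone moment is
driven down) below elevation 24.6° and above 53.2°, positive (driven up, adverse) in between. -/
theorem coneKernel_conveyor_bracket (ρ z v : ℝ) (hv : v ^ 2 * (ρ ^ 2 + z ^ 2) = 1) :
    -(ρ / 2) * ((12 * z ^ 3 * ρ ^ 2 - 15 * z * ρ ^ 4) * v ^ 9 + (4 * z ^ 3 * ρ ^ 3 - 3 * z * ρ ^ 5) * (-9 * v ^ 10 * (ρ * v)))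
      + z * ((12 * z ^ 2 * ρ ^ 3 - 3 * ρ ^ 5) * v ^ 9 + (4 * z ^ 3 * ρ ^ 3 - 3 * z * ρ ^ 5) * (-9 * v ^ 10 * (z * v)))
      + 1 / 2 * ((4 * z ^ 3 * ρ ^ 3 - 3 * z * ρ ^ 5) * v ^ 9)
    = -(7 / 2) * z * ρ ^ 3 * (8 * z ^ 4 - 16 * z ^ 2 * ρ ^ 2 + 3 * ρ ^ 4) * v ^ 11 := by
  linear_combination (-(v ^ 9) * (z * ρ ^ 3 * (8 * z ^ 2 + 3 * ρ ^ 2))) * hv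

/-- SOURCE KERNEL. `∂_z K₂ = ∂_zP·v⁹ + P·(−9v¹⁰·zv) = ρ³(−24z⁴ + 36z²ρ² − 3ρ⁴)·v¹¹` modulo `v²(ρ² + z²) = 1`: after
`∫∫ K₂ ∂_z(u₁²) = −∫∫ u₁² ∂_zK₂`, the swirl `u₁²` feeds the cone moment positively below 16.6°, negatively between 16.6° and
49.9°, positively above. -/
theorem coneKernel_dz (ρ z v : ℝ) (hv : v ^ 2 * (ρ ^ 2 + z ^ 2) = 1) :
    (12 * z ^ 2 * ρ ^ 3 - 3 * ρ ^ 5) * v ^ 9 + (4 * z ^ 3 * ρ ^ 3 - 3 * z * ρ ^ 5) * (-9 * v ^ 10 * (z * v))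
    = ρ ^ 3 * (-24 * z ^ 4 + 36 * z ^ 2 * ρ ^ 2 - 3 * ρ ^ 4) * v ^ 11 := by
  linear_combination (-(v ^ 9) * (12 * z ^ 2 * ρ ^ 3 - 3 * ρ ^ 5)) * hv

end KernelAlgebra

/-- THE ADVERSE BAND. In the variable `t = (z/ρ)²` the conveyor bracket of the cone kernel carries the factor
`−(8t² − 16t + 3)`; it is positive exactly for `1 − √10/4 < t < 1 + √10/4`, i.e. for elevations between
`arctan √(1 − √10/4) ≈ 24.6°` and `arctan √(1 + √10/4) ≈ 53.2°` — a band containing the cone angle 40.9°. -/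
theorem conveyorBracket_neg_iff (t : ℝ) :
    8 * t ^ 2 - 16 * t + 3 < 0 ↔ 1 - Real.sqrt 10 / 4 < t ∧ t < 1 + Real.sqrt 10 / 4 := by
  have h10 : Real.sqrt 10 ^ 2 = 10 := Real.sq_sqrt (by norm_num)
  have h10' : 0 ≤ Real.sqrt 10 := Real.sqrt_nonneg 10
  constructor
  · intro h
    have hsq : (t - 1) ^ 2 < (Real.sqrt 10 / 4) ^ 2 := by nlinarith [h10]
    have habs : |t - 1| < Real.sqrt 10 / 4 := abs_lt_of_sq_lt_sq hsq (by positivity)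
    rcases abs_lt.mp habs with ⟨h1, h2⟩
    constructor <;> linarith
  · rintro ⟨h1, h2⟩
    nlinarith [h10, h1, h2, mul_pos (by linarith : 0 < t - (1 - Real.sqrt 10 / 4))
      (by linarith : 0 < (1 + Real.sqrt 10 / 4) - t)]

/-- THE SWEPT CONE. The linear conveyor maps `(ρ', z) ↦ (ρ'/E… )`; written multiplicatively: a parcel now at radius
`ρ'` with `ρ' E = ρ` (it started at `ρ`) and at height `z E²` (it started at `z`), `E = e^{τ/2} > 0`, sees the cone-kernel
factor `4(zE²)² − 3ρ'²`, which is positive iff `(√3/2)ρ < zE³`: in the INITIAL coordinates the nodal cone has slope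
`(√3/2)E⁻³ = (√3/2)e^{−3τ/2}` — it sweeps down to the symmetry plane exponentially in strain time, so every parcel of
the initial layer ends up above it (lifting through the 40.9° cone is generic at the linear level). -/
theorem sweptCone_pos_iff (ρ ρ' z E : ℝ) (hρ' : 0 < ρ') (hz : 0 < z) (hE : 0 < E) (hρ : ρ' * E = ρ) :
    0 < 4 * (z * E ^ 2) ^ 2 - 3 * ρ' ^ 2 ↔ Real.sqrt 3 / 2 * ρ < z * E ^ 3 := by
  have h3 : Real.sqrt 3 ^ 2 = 3 := Real.sq_sqrt (by norm_num)
  have h3' : 0 ≤ Real.sqrt 3 := Real.sqrt_nonneg 3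
  subst hρ
  have hzE : 0 < z * E ^ 2 := by positivity
  have hpos : 0 ≤ Real.sqrt 3 / 2 * ρ' := by positivity
  -- first the undilated statement for s = z E², then multiply through by E > 0
  have step : 0 < 4 * (z * E ^ 2) ^ 2 - 3 * ρ' ^ 2 ↔ Real.sqrt 3 / 2 * ρ' < z * E ^ 2 := by
    constructor
    · intro h
      by_contra hlt
      have hle : z * E ^ 2 ≤ Real.sqrt 3 / 2 * ρ' := not_lt.mp hlt
      have hsq : (z * E ^ 2) * (z * E ^ 2) ≤ (Real.sqrt 3 / 2 * ρ') * (Real.sqrt 3 / 2 * ρ') :=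
        mul_self_le_mul_self (le_of_lt hzE) hle
      nlinarith [hsq, h3]
    · intro h
      have hsq : (Real.sqrt 3 / 2 * ρ') * (Real.sqrt 3 / 2 * ρ') < (z * E ^ 2) * (z * E ^ 2) :=
        mul_self_lt_mul_self hpos h
      nlinarith [hsq, h3]
  rw [step]
  constructor
  · intro h
    have := mul_lt_mul_of_pos_right h hE
    calc Real.sqrt 3 / 2 * (ρ' * E) = Real.sqrt 3 / 2 * ρ' * E := by ring
      _ < z * E ^ 2 * E := this
      _ = z * E ^ 3 := by ring
  · intro h
    have h' : Real.sqrt 3 / 2 * ρ' * E < z * E ^ 2 * E := by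
      calc Real.sqrt 3 / 2 * ρ' * E = Real.sqrt 3 / 2 * (ρ' * E) := by ring
        _ < z * E ^ 3 := h
        _ = z * E ^ 2 * E := by ring
    exact lt_of_mul_lt_mul_right h' (le_of_lt hE)

/-- NEUTRALITY OF A z-LINEAR COLUMN SOURCE (Gamma core). The lifetime cone moment `M(a)` of a parcel born at slope `a`
integrates, against the weight `a` (a source `∝ z` along a vertical), to `½[4B(5/2,2) − 3B(3/2,3)]`; this vanishes because
`4Γ(5/2)Γ(2) = 3Γ(3/2)Γ(3)` (both Beta values are `·/Γ(9/2)`). -/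
theorem neutralColumn_gamma :
    4 * (Real.Gamma (5 / 2) * Real.Gamma 2) = 3 * (Real.Gamma (3 / 2) * Real.Gamma 3) := by
  have h52 : Real.Gamma (5 / 2) = 3 / 2 * Real.Gamma (3 / 2) := by
    rw [show (5 / 2 : ℝ) = 3 / 2 + 1 by norm_num, Real.Gamma_add_one (by norm_num)]
  have h2 : Real.Gamma 2 = 1 := by
    rw [show (2 : ℝ) = 1 + 1 by norm_num, Real.Gamma_add_one (by norm_num), Real.Gamma_one]; norm_num
  have h3 : Real.Gamma 3 = 2 := by
    rw [show (3 : ℝ) = 2 + 1 by norm_num, Real.Gamma_add_one (by norm_num), h2]; norm_num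
  rw [h52, h2, h3]
  ring

end Summit.NavierStokesRegularity.NavierStokesRegularity.Theorems
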